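import Mathlib.Analysis.Fourier.AddCircle
import Mathlib.Analysis.InnerProductSpace.Adjoint
import Mathlib.MeasureTheory.Integral.IntervalIntegral.Periodic
import Mathlib.Analysis.SpecialFunctions.Integrals.Basic
import HarnessLib

/-!
# Charge sectors of a periodic one-parameter unitary group (Fourier decomposition of a
  strongly continuous representation of the circle on a Hilbert space)

Analysis/OperatorTheory file (one `Prop` structure of hypotheses, one definition with body, all
theorems proved, no named facts). Let `U : ℝ → 𝓑(H)` be a strongly continuous one-parameter
unitary group on a complex Hilbert space which is `2π`-PERIODIC, `U(t + 2π) = U(t)` — a unitary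
representation of the circle group `U(1)`: the global gauge / rotation symmetry `θ ↦ θ + t` of
`XY`-, rotor- and Bose-type models, whose "charge-`n` sectors" are the isotypic components. The
Peter–Weyl / Fourier decomposition for this simplest compact group is elementary (Stone–von
Neumann era; e.g. Bratteli–Robinson, *Operator Algebras and Quantum Statistical Mechanics 1*,
§2.7.1 and §3.2.3 on spectral subspaces of periodic groups; Reed–Simon I, Thm. VIII.8 ff.) but is
not in Mathlib. We prove it from Mathlib's Fourier series on `AddCircle`:

* `IsPeriodicUnitaryGroup U` — the hypotheses (`U 0 = 1`, `U(s+t) = U s U t`, `U(t+2π) = U t`,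
  `⟪U t x, y⟫ = ⟪x, U(−t) y⟫`, strong continuity);
* `IsPeriodicUnitaryGroup.sectorProj hU n : H →L[ℂ] H` — **the charge-`n` projection**
  `Pₙ x = (2π)⁻¹ ∫₀^{2π} e^{−int} U(t) x dt` (a strong Bochner/interval integral), `‖Pₙ‖ ≤ 1`;
* `apply_sectorProj` — **covariance** `U(s) Pₙ x = e^{ins} Pₙ x`; `sectorProj_apply_eq_self_iff` —
  `Ran Pₙ = {x | ∀ t, U t x = e^{int} x}` is the charge-`n` sector;
* `sectorProj_apply_sectorProj_self` / `_of_ne` — `Pₙ² = Pₙ`, `Pₘ Pₙ = 0` (`m ≠ n`);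
  `inner_sectorProj_left` — `Pₙ* = Pₙ`; hence the sectors are pairwise orthogonal
  (`inner_sectorProj_sectorProj_of_ne`);
* `sectorProj_comm_of_commute` — **a bounded operator commuting with every `U t` commutes with every
  `Pₙ`** (so it is reduced by the sectors: transfer operators of `U(1)`-invariant models are block
  diagonal in the charge);
* `norm_sum_sectorProj_sq`, `sum_norm_sectorProj_sq_le` (Bessel), `summable_sectorProj_apply`, and
  **completeness** `hasSum_sectorProj_apply : Σₙ Pₙ x = x` — the only analytic input being that a
  continuous function on the circle all of whose Fourier coefficients vanish is zero (Mathlib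
  `hasSum_fourier_series_of_summable`), applied to the matrix coefficients `t ↦ ⟪w, U t z⟫`;
  `eq_zero_of_forall_sectorProj_eq_zero`, `norm_sq_eq_tsum` (Parseval/Plancherel for the group).

## Mathlib / tree search

Mathlib: `fourierCoeffOn_eq_integral`, `fourierCoeff_liftIco_eq`, `AddCircle.liftIco_zero_continuous`,
`hasSum_fourier_series_of_summable`, `Function.Periodic.intervalIntegral_add_eq`,
`integral_exp_mul_complex`, `ContinuousLinearMap.intervalIntegral_comp_comm`, `integral_inner`,
`summable_iff_vanishing_norm`; no isotypic / spectral-subspace decomposition of unitary groups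
(searched `isotypic`, `spectral subspace`, `sectorProj`; tree: `ModularGroupSubspace` builds a
particular unitary group only).

## References

* O. Bratteli, D. W. Robinson, *Operator Algebras and Quantum Statistical Mechanics 1*, 2nd ed.,
  Springer 1987, §3.2.3 (spectral subspaces of automorphism/unitary groups; periodic case). [folklore]
* M. Reed, B. Simon, *Methods of Modern Mathematical Physics I*, Academic Press 1980, §VIII.4
  (Stone's theorem) and Problem VIII.31 (representations of compact abelian groups). [folklore]
-/

noncomputable section

open Complex MeasureTheory Set Filter Topology intervalIntegral
open scoped InnerProductSpace Real

namespace Literature.Analysis.OperatorTheory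

variable {H : Type*} [NormedAddCommGroup H] [InnerProductSpace ℂ H] [CompleteSpace H]

/-- **A `2π`-periodic strongly continuous one-parameter unitary group** on a complex Hilbert space
(a unitary representation of the circle): group law, periodicity, unitarity in the form
`⟪U t x, y⟫ = ⟪x, U (−t) y⟫` (i.e. `(U t)* = U(−t) = (U t)⁻¹`), and strong continuity. [folklore] -/
structure IsPeriodicUnitaryGroup (U : ℝ → H →L[ℂ] H) : Prop where
  /-- `U 0 = 1`. -/
  map_zero : U 0 = 1
  /-- The group law `U (s + t) = U s ∘ U t`. -/
  map_add : ∀ s t, U (s + t) = U s * U t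
  /-- Periodicity `U (t + 2π) = U t`. -/
  periodic : ∀ t, U (t + 2 * π) = U t
  /-- Unitarity: `(U t)* = U (−t)`. -/
  inner_map : ∀ t (x y : H), ⟪U t x, y⟫_ℂ = ⟪x, U (-t) y⟫_ℂ
  /-- Strong continuity of the orbits. -/
  continuous_apply : ∀ x, Continuous fun t => U t x

namespace IsPeriodicUnitaryGroup

variable {U : ℝ → H →L[ℂ] H}

/-! ### Elementary consequences of the axioms -/

omit [CompleteSpace H] in
/-- `U (−t) ∘ U t = 1`. [folklore] -/
theorem map_neg_mul_self (hU : IsPeriodicUnitaryGroup U) (t : ℝ) : U (-t) * U t = 1 := by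
  rw [← hU.map_add, neg_add_cancel, hU.map_zero]

omit [CompleteSpace H] in
/-- `U t ∘ U (−t) = 1`. [folklore] -/
theorem map_self_mul_neg (hU : IsPeriodicUnitaryGroup U) (t : ℝ) : U t * U (-t) = 1 := by
  rw [← hU.map_add, add_neg_cancel, hU.map_zero]

omit [CompleteSpace H] in
/-- The operators `U s`, `U t` commute (the group is abelian). [folklore] -/
theorem map_comm (hU : IsPeriodicUnitaryGroup U) (s t : ℝ) : U s * U t = U t * U s := by
  rw [← hU.map_add, ← hU.map_add, add_comm]

omit [CompleteSpace H] in
/-- **Unitarity: `‖U t x‖ = ‖x‖`.** [folklore] -/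
theorem norm_map (hU : IsPeriodicUnitaryGroup U) (t : ℝ) (x : H) : ‖U t x‖ = ‖x‖ := by
  have h : ⟪U t x, U t x⟫_ℂ = ⟪x, x⟫_ℂ := by
    rw [hU.inner_map, show U (-t) (U t x) = (U (-t) * U t) x from rfl, hU.map_neg_mul_self]
    rfl
  rw [inner_self_eq_norm_sq_to_K, inner_self_eq_norm_sq_to_K] at h
  have h2 : ‖U t x‖ ^ 2 = ‖x‖ ^ 2 := by exact_mod_cast h
  exact (sq_eq_sq₀ (norm_nonneg _) (norm_nonneg _)).1 h2

omit [CompleteSpace H] in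
/-- Periodicity with integer multiples: `U (t + 2πk) = U t`. [folklore] -/
theorem periodic' (hU : IsPeriodicUnitaryGroup U) : Function.Periodic U (2 * π) := hU.periodic

/-! ### The charge-`n` Fourier integrand -/

omit [CompleteSpace H] in
/-- The integrand `t ↦ e^{−int} U(t) x` of the charge-`n` projection is continuous. [folklore] -/
theorem continuous_integrand (hU : IsPeriodicUnitaryGroup U) (n : ℤ) (x : H) :
    Continuous fun t : ℝ => exp (-(I * n * t)) • U t x :=
  (Complex.continuous_exp.comp ((continuous_const.mul continuous_ofReal).neg)).smul
    (hU.continuous_apply x)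

/-- `e^{−in(t + 2π)} = e^{−int}` for an integer `n`. [folklore] -/
theorem exp_neg_I_mul_add_two_pi (n : ℤ) (t : ℝ) :
    exp (-(I * n * ((t + 2 * π : ℝ) : ℂ))) = exp (-(I * n * t)) := by
  have h : -(I * n * ((t + 2 * π : ℝ) : ℂ)) = -(I * n * t) + (-n : ℤ) * (2 * π * I) := by
    push_cast; ring
  rw [h, Complex.exp_add, exp_int_mul_two_pi_mul_I, mul_one]

omit [CompleteSpace H] in
/-- The integrand is `2π`-periodic. [folklore] -/
theorem periodic_integrand (hU : IsPeriodicUnitaryGroup U) (n : ℤ) (x : H) :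
    Function.Periodic (fun t : ℝ => exp (-(I * n * t)) • U t x) (2 * π) := fun t => by
  simp only
  rw [exp_neg_I_mul_add_two_pi, hU.periodic]

omit [CompleteSpace H] in
/-- The integrand has norm `‖x‖` (`|e^{−int}| = 1`, `U t` unitary). [folklore] -/
theorem norm_integrand (hU : IsPeriodicUnitaryGroup U) (n : ℤ) (x : H) (t : ℝ) :
    ‖exp (-(I * n * t)) • U t x‖ = ‖x‖ := by
  rw [norm_smul, hU.norm_map]
  have h : -(I * n * t) = ((-(n * t) : ℝ) : ℂ) * I := by push_cast; ring
  rw [h, Complex.norm_exp_ofReal_mul_I, one_mul]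

/-! ### The charge projections -/

/-- **The charge-`n` projection** `Pₙ x = (2π)⁻¹ ∫₀^{2π} e^{−int} U(t) x dt` of a periodic unitary
group: the orthogonal projection onto the isotypic component where `U(t)` acts by `e^{int}`.
[folklore] -/
def sectorProj (hU : IsPeriodicUnitaryGroup U) (n : ℤ) : H →L[ℂ] H :=
  LinearMap.mkContinuous
    { toFun := fun x => (1 / (2 * π) : ℝ) • ∫ t in (0 : ℝ)..2 * π, exp (-(I * n * t)) • U t x
      map_add' := fun x y => by
        have hx := (hU.continuous_integrand n x).intervalIntegrable (μ := volume) 0 (2 * π)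
        have hy := (hU.continuous_integrand n y).intervalIntegrable (μ := volume) 0 (2 * π)
        have h : (fun t : ℝ => exp (-(I * n * t)) • U t (x + y)) =
            fun t : ℝ => exp (-(I * n * t)) • U t x + exp (-(I * n * t)) • U t y := by
          funext t; rw [_root_.map_add, smul_add]
        show (1 / (2 * π) : ℝ) • (∫ t in (0 : ℝ)..2 * π, exp (-(I * n * t)) • U t (x + y)) =
          (1 / (2 * π) : ℝ) • (∫ t in (0 : ℝ)..2 * π, exp (-(I * n * t)) • U t x) +
            (1 / (2 * π) : ℝ) • ∫ t in (0 : ℝ)..2 * π, exp (-(I * n * t)) • U t y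
        rw [h, intervalIntegral.integral_add hx hy, smul_add]
      map_smul' := fun c x => by
        have h : (fun t : ℝ => exp (-(I * n * t)) • U t (c • x)) =
            fun t : ℝ => c • (exp (-(I * n * t)) • U t x) := by
          funext t; rw [_root_.map_smul, smul_comm]
        show (1 / (2 * π) : ℝ) • (∫ t in (0 : ℝ)..2 * π, exp (-(I * n * t)) • U t (c • x)) =
          c • ((1 / (2 * π) : ℝ) • ∫ t in (0 : ℝ)..2 * π, exp (-(I * n * t)) • U t x)
        rw [h, intervalIntegral.integral_smul]
        exact smul_comm _ _ _ }
    1 fun x => by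
      simp only [LinearMap.coe_mk, AddHom.coe_mk, one_mul]
      rw [norm_smul, Real.norm_eq_abs, abs_of_pos (by positivity)]
      have hb : ‖∫ t in (0 : ℝ)..2 * π, exp (-(I * n * t)) • U t x‖ ≤ ‖x‖ * |2 * π - 0| :=
        intervalIntegral.norm_integral_le_of_norm_le_const fun t _ => (hU.norm_integrand n x t).le
      rw [sub_zero, abs_of_pos Real.two_pi_pos] at hb
      calc 1 / (2 * π) * ‖∫ t in (0 : ℝ)..2 * π, exp (-(I * n * t)) • U t x‖
          ≤ 1 / (2 * π) * (‖x‖ * (2 * π)) := by gcongr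
        _ = ‖x‖ := by field_simp

omit [CompleteSpace H] in
/-- Unfolding the charge projection. [folklore] -/
theorem sectorProj_apply (hU : IsPeriodicUnitaryGroup U) (n : ℤ) (x : H) :
    hU.sectorProj n x = (1 / (2 * π) : ℝ) • ∫ t in (0 : ℝ)..2 * π, exp (-(I * n * t)) • U t x := rfl

omit [CompleteSpace H] in
/-- `‖Pₙ x‖ ≤ ‖x‖`. [folklore] -/
theorem norm_sectorProj_apply_le (hU : IsPeriodicUnitaryGroup U) (n : ℤ) (x : H) :
    ‖hU.sectorProj n x‖ ≤ ‖x‖ := by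
  have h := (hU.sectorProj n).le_of_opNorm_le (LinearMap.mkContinuous_norm_le _ zero_le_one _) x
  simpa using h

omit [CompleteSpace H] in
/-- The integral over any period: `∫ₛ^{s+2π} e^{−int} U(t) x dt = ∫₀^{2π} e^{−int} U(t) x dt`. [folklore] -/
theorem integral_integrand_add_eq (hU : IsPeriodicUnitaryGroup U) (n : ℤ) (x : H) (s : ℝ) :
    (∫ t in s..s + 2 * π, exp (-(I * n * t)) • U t x) = ∫ t in (0 : ℝ)..2 * π, exp (-(I * n * t)) • U t x := by
  have h := (hU.periodic_integrand n x).intervalIntegral_add_eq s 0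
  rwa [zero_add] at h

/-! ### Covariance: `U(s) Pₙ = e^{ins} Pₙ` -/

/-- **`U(s) Pₙ x = e^{ins} Pₙ x`**: the range of `Pₙ` consists of charge-`n` vectors (substitute
`t ↦ t − s` in the integral and use periodicity). [folklore] -/
theorem apply_sectorProj (hU : IsPeriodicUnitaryGroup U) (n : ℤ) (s : ℝ) (x : H) :
    U s (hU.sectorProj n x) = exp (I * n * s) • hU.sectorProj n x := by
  rw [sectorProj_apply, ContinuousLinearMap.map_smul_of_tower, smul_comm]
  congr 1
  have hint : IntervalIntegrable (fun t : ℝ => exp (-(I * n * t)) • U t x) volume 0 (2 * π) :=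
    (hU.continuous_integrand n x).intervalIntegrable _ _
  rw [← (U s).intervalIntegral_comp_comm hint]
  -- `U s (e^{-int} U t x) = e^{ins} (e^{-in(t+s)} U (t+s) x)`
  have hpt : (fun t : ℝ => U s (exp (-(I * n * t)) • U t x)) =
      fun t => exp (I * n * s) • (exp (-(I * n * ((t + s : ℝ) : ℂ))) • U (t + s) x) := by
    funext t
    rw [ContinuousLinearMap.map_smul_of_tower, show U s (U t x) = (U s * U t) x from rfl, ← hU.map_add,
      add_comm s t, smul_smul, ← Complex.exp_add]
    congr 2
    push_cast; ring
  rw [hpt, intervalIntegral.integral_smul,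
    intervalIntegral.integral_comp_add_right (fun t : ℝ => exp (-(I * n * t)) • U t x) s, zero_add,
    show 2 * π + s = s + 2 * π by ring, hU.integral_integrand_add_eq n x s]

/-! ### Orthogonality relations: `Pₘ Pₙ = δ_{mn} Pₙ` -/

/-- `∫₀^{2π} e^{ikt} dt = 0` for a non-zero integer `k`. [folklore] -/
theorem integral_exp_I_int_mul {k : ℤ} (hk : k ≠ 0) :
    (∫ t in (0 : ℝ)..2 * π, exp (I * k * t)) = 0 := by
  have hc : (I * k : ℂ) ≠ 0 := mul_ne_zero I_ne_zero (Int.cast_ne_zero.2 hk)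
  have h := integral_exp_mul_complex (a := 0) (b := 2 * π) hc
  have h1 : exp (I * k * ((2 * π : ℝ) : ℂ)) = 1 := by
    rw [show I * k * ((2 * π : ℝ) : ℂ) = k * (2 * π * I) by push_cast; ring, exp_int_mul_two_pi_mul_I]
  simp only [Complex.ofReal_zero, mul_zero, Complex.exp_zero] at h
  rw [show (fun t : ℝ => exp (I * k * t)) = fun t : ℝ => exp (I * ↑k * ↑t) from rfl, h, h1, sub_self,
    zero_div]

/-- **`Pₘ y = 0` for a charge-`n` vector `y` with `m ≠ n`**, and **`Pₙ y = y`**: the action of the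
projections on a vector with `U t y = e^{int} y`. [folklore] -/
theorem sectorProj_apply_of_charge (hU : IsPeriodicUnitaryGroup U) {n : ℤ} {y : H}
    (hy : ∀ t : ℝ, U t y = exp (I * n * t) • y) (m : ℤ) :
    hU.sectorProj m y = if m = n then y else 0 := by
  rw [sectorProj_apply]
  have hpt : (fun t : ℝ => exp (-(I * m * t)) • U t y) =
      fun t : ℝ => exp (I * ((n - m : ℤ) : ℂ) * (t : ℂ)) • y := by
    funext t
    rw [hy t, smul_smul, ← Complex.exp_add]
    congr 2
    push_cast; ring
  rw [hpt]
  split_ifs with hmn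
  · rw [hmn]
    have h0 : (fun t : ℝ => exp (I * ((n - n : ℤ) : ℂ) * (t : ℂ)) • y) = fun _ => y := by
      funext t; simp
    rw [h0, intervalIntegral.integral_const, sub_zero, smul_smul,
      one_div_mul_cancel Real.two_pi_pos.ne', one_smul]
  · rw [intervalIntegral.integral_smul_const, integral_exp_I_int_mul (sub_ne_zero.2 (Ne.symm hmn)),
      zero_smul, smul_zero]

/-- **`Pₙ (Pₙ x) = Pₙ x`** (idempotency). [folklore] -/
theorem sectorProj_apply_sectorProj_self (hU : IsPeriodicUnitaryGroup U) (n : ℤ) (x : H) :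
    hU.sectorProj n (hU.sectorProj n x) = hU.sectorProj n x := by
  rw [hU.sectorProj_apply_of_charge (fun t => hU.apply_sectorProj n t x) n, if_pos rfl]

/-- **`Pₘ (Pₙ x) = 0` for `m ≠ n`** (distinct charge sectors are independent). [folklore] -/
theorem sectorProj_apply_sectorProj_of_ne (hU : IsPeriodicUnitaryGroup U) {m n : ℤ} (hmn : m ≠ n)
    (x : H) : hU.sectorProj m (hU.sectorProj n x) = 0 := by
  rw [hU.sectorProj_apply_of_charge (fun t => hU.apply_sectorProj n t x) m, if_neg hmn]

/-- `Pₙ² = Pₙ` as operators. [folklore] -/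
theorem sectorProj_mul_self (hU : IsPeriodicUnitaryGroup U) (n : ℤ) :
    hU.sectorProj n * hU.sectorProj n = hU.sectorProj n :=
  ContinuousLinearMap.ext fun x => hU.sectorProj_apply_sectorProj_self n x

/-- `Pₘ Pₙ = 0` for `m ≠ n`. [folklore] -/
theorem sectorProj_mul_sectorProj_of_ne (hU : IsPeriodicUnitaryGroup U) {m n : ℤ} (hmn : m ≠ n) :
    hU.sectorProj m * hU.sectorProj n = 0 :=
  ContinuousLinearMap.ext fun x => hU.sectorProj_apply_sectorProj_of_ne hmn x

/-- **The range of `Pₙ` is exactly the charge-`n` sector**: `Pₙ x = x ↔ ∀ t, U t x = e^{int} x`.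
[folklore] -/
theorem sectorProj_apply_eq_self_iff (hU : IsPeriodicUnitaryGroup U) (n : ℤ) (x : H) :
    hU.sectorProj n x = x ↔ ∀ t : ℝ, U t x = exp (I * n * t) • x := by
  constructor
  · intro h t
    rw [← h, hU.apply_sectorProj, h]
  · intro h
    rw [hU.sectorProj_apply_of_charge h n, if_pos rfl]

/-! ### Self-adjointness: `Pₙ* = Pₙ` -/

/-- **`⟪x, Pₙ y⟫ = (2π)⁻¹ ∫₀^{2π} e^{−int} ⟪x, U t y⟫ dt`**: matrix coefficients of the charge
projection are the Fourier coefficients of the matrix coefficients of the group. [folklore] -/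
theorem inner_sectorProj_right (hU : IsPeriodicUnitaryGroup U) (n : ℤ) (x y : H) :
    ⟪x, hU.sectorProj n y⟫_ℂ =
      (1 / (2 * π) : ℝ) • ∫ t in (0 : ℝ)..2 * π, exp (-(I * n * t)) * ⟪x, U t y⟫_ℂ := by
  have hint : IntervalIntegrable (fun t : ℝ => exp (-(I * n * t)) • U t y) volume 0 (2 * π) :=
    (hU.continuous_integrand n y).intervalIntegrable _ _
  rw [sectorProj_apply, RCLike.real_smul_eq_coe_smul (K := ℂ), inner_smul_real_right]
  congr 1
  rw [← innerSL_apply_apply (𝕜 := ℂ), ← (innerSL ℂ x).intervalIntegral_comp_comm hint]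
  refine intervalIntegral.integral_congr fun t _ => ?_
  show innerSL ℂ x (exp (-(I * n * t)) • U t y) = exp (-(I * n * t)) * ⟪x, U t y⟫_ℂ
  rw [innerSL_apply_apply, inner_smul_right]

/-- **`⟪Pₙ x, y⟫ = ⟪x, Pₙ y⟫`** (`Pₙ` is self-adjoint; with idempotency it is the ORTHOGONAL
projection onto the charge-`n` sector). Proof: conjugate the integral formula,
`conj (e^{−int}⟪y, U t x⟫) = e^{int}⟪x, U(−t) y⟫`, substitute `t ↦ −t` and use periodicity. [folklore] -/
theorem inner_sectorProj_left (hU : IsPeriodicUnitaryGroup U) (n : ℤ) (x y : H) :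
    ⟪hU.sectorProj n x, y⟫_ℂ = ⟪x, hU.sectorProj n y⟫_ℂ := by
  rw [← inner_conj_symm, hU.inner_sectorProj_right, hU.inner_sectorProj_right, Complex.real_smul,
    Complex.real_smul, map_mul, Complex.conj_ofReal, ← intervalIntegral_conj]
  congr 1
  -- conjugate pointwise and substitute `t ↦ -t`
  have hneg : (∫ t in (0 : ℝ)..2 * π, (starRingEnd ℂ) (exp (-(I * n * t)) * ⟪y, U t x⟫_ℂ)) =
      ∫ t in (0 : ℝ)..2 * π, (fun s : ℝ => exp (-(I * n * s)) * ⟪x, U s y⟫_ℂ) (-t) := by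
    refine intervalIntegral.integral_congr fun t _ => ?_
    show (starRingEnd ℂ) (exp (-(I * n * t)) * ⟪y, U t x⟫_ℂ) =
      exp (-(I * n * ((-t : ℝ) : ℂ))) * ⟪x, U (-t) y⟫_ℂ
    rw [map_mul, inner_conj_symm, ← Complex.exp_conj, hU.inner_map]
    congr 2
    simp only [map_neg, map_mul, Complex.conj_I, Complex.conj_ofReal, map_intCast]
    push_cast
    ring
  rw [hneg, intervalIntegral.integral_comp_neg (fun s : ℝ => exp (-(I * n * s)) * ⟪x, U s y⟫_ℂ),
    neg_zero]
  -- shift by a period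
  have hper : Function.Periodic (fun t : ℝ => exp (-(I * n * t)) * ⟪x, U t y⟫_ℂ) (2 * π) := fun t => by
    show exp (-(I * n * ((t + 2 * π : ℝ) : ℂ))) * ⟪x, U (t + 2 * π) y⟫_ℂ = exp (-(I * n * t)) * ⟪x, U t y⟫_ℂ
    rw [exp_neg_I_mul_add_two_pi, hU.periodic]
  have h := hper.intervalIntegral_add_eq (-(2 * π)) 0
  rw [neg_add_cancel, zero_add] at h
  exact h

/-- `Pₙ` is self-adjoint. [folklore] -/
theorem isSelfAdjoint_sectorProj (hU : IsPeriodicUnitaryGroup U) (n : ℤ) :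
    IsSelfAdjoint (hU.sectorProj n) := by
  rw [ContinuousLinearMap.isSelfAdjoint_iff_isSymmetric]
  exact fun x y => hU.inner_sectorProj_left n x y

/-- `⟪x, Pₙ x⟫ = ⟪Pₙ x, Pₙ x⟫ (= ‖Pₙ x‖²)`. [folklore] -/
theorem inner_sectorProj_self (hU : IsPeriodicUnitaryGroup U) (n : ℤ) (x : H) :
    ⟪x, hU.sectorProj n x⟫_ℂ = ⟪hU.sectorProj n x, hU.sectorProj n x⟫_ℂ := by
  rw [hU.inner_sectorProj_left n x (hU.sectorProj n x), hU.sectorProj_apply_sectorProj_self]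

/-- **Distinct sectors are orthogonal**: `⟪Pₘ x, Pₙ y⟫ = 0` for `m ≠ n`. [folklore] -/
theorem inner_sectorProj_sectorProj_of_ne (hU : IsPeriodicUnitaryGroup U) {m n : ℤ} (hmn : m ≠ n)
    (x y : H) : ⟪hU.sectorProj m x, hU.sectorProj n y⟫_ℂ = 0 := by
  rw [hU.inner_sectorProj_left, hU.sectorProj_apply_sectorProj_of_ne hmn, inner_zero_right]

/-! ### Invariant operators are reduced by the sectors -/

/-- **An operator commuting with the group commutes with every charge projection**:
`A ∘ U t = U t ∘ A` for all `t` implies `A (Pₙ x) = Pₙ (A x)` (pull `A` through the integral).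
Hence `U(1)`-invariant transfer operators are block diagonal in the charge sectors. [folklore] -/
theorem sectorProj_comm_of_commute (hU : IsPeriodicUnitaryGroup U) {A : H →L[ℂ] H}
    (hA : ∀ t, A * U t = U t * A) (n : ℤ) (x : H) : A (hU.sectorProj n x) = hU.sectorProj n (A x) := by
  rw [sectorProj_apply, sectorProj_apply, ContinuousLinearMap.map_smul_of_tower]
  congr 1
  have hint : IntervalIntegrable (fun t : ℝ => exp (-(I * n * t)) • U t x) volume 0 (2 * π) :=
    (hU.continuous_integrand n x).intervalIntegrable _ _
  rw [← A.intervalIntegral_comp_comm hint]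
  refine intervalIntegral.integral_congr fun t _ => ?_
  show A (exp (-(I * n * t)) • U t x) = exp (-(I * n * t)) • U t (A x)
  rw [ContinuousLinearMap.map_smul_of_tower, show A (U t x) = (A * U t) x from rfl, hA t]
  rfl

/-- Operator form: `A Pₙ = Pₙ A`. [folklore] -/
theorem commute_sectorProj (hU : IsPeriodicUnitaryGroup U) {A : H →L[ℂ] H}
    (hA : ∀ t, A * U t = U t * A) (n : ℤ) : Commute A (hU.sectorProj n) :=
  ContinuousLinearMap.ext fun x => hU.sectorProj_comm_of_commute hA n x

/-- In particular the group itself commutes with the projections: `U s Pₙ = Pₙ U s`. [folklore] -/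
theorem map_sectorProj_comm (hU : IsPeriodicUnitaryGroup U) (s : ℝ) (n : ℤ) (x : H) :
    U s (hU.sectorProj n x) = hU.sectorProj n (U s x) :=
  hU.sectorProj_comm_of_commute (fun t => hU.map_comm s t) n x

/-! ### Bessel's inequality and summability of `Σₙ Pₙ x` -/

omit [CompleteSpace H] in
/-- Pythagoras for a finite family of pairwise orthogonal vectors. [folklore] -/
theorem norm_sum_sq_of_pairwise_inner_eq_zero {ι : Type*} (v : ι → H) (s : Finset ι)
    (h : ∀ i ∈ s, ∀ j ∈ s, i ≠ j → ⟪v i, v j⟫_ℂ = 0) :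
    ‖∑ i ∈ s, v i‖ ^ 2 = ∑ i ∈ s, ‖v i‖ ^ 2 := by
  classical
  induction s using Finset.induction_on with
  | empty => simp
  | insert a s ha ih =>
    rw [Finset.sum_insert ha, Finset.sum_insert ha]
    have horth : ⟪v a, ∑ i ∈ s, v i⟫_ℂ = 0 := by
      rw [inner_sum]
      exact Finset.sum_eq_zero fun j hj => h a (Finset.mem_insert_self a s) j
        (Finset.mem_insert_of_mem hj) (fun hij => ha (hij ▸ hj))
    have hp := norm_add_sq_eq_norm_sq_add_norm_sq_of_inner_eq_zero _ _ horth
    rw [sq, hp, ← sq, ← sq,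
      ih fun i hi j hj hij => h i (Finset.mem_insert_of_mem hi) j (Finset.mem_insert_of_mem hj) hij]

/-- **`‖Σ_{n∈S} Pₙ x‖² = Σ_{n∈S} ‖Pₙ x‖²`** for every finite set of charges. [folklore] -/
theorem norm_sum_sectorProj_sq (hU : IsPeriodicUnitaryGroup U) (x : H) (S : Finset ℤ) :
    ‖∑ n ∈ S, hU.sectorProj n x‖ ^ 2 = ∑ n ∈ S, ‖hU.sectorProj n x‖ ^ 2 :=
  norm_sum_sq_of_pairwise_inner_eq_zero _ S fun _ _ _ _ hij =>
    hU.inner_sectorProj_sectorProj_of_ne hij x x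

/-- **Bessel's inequality**: `Σ_{n∈S} ‖Pₙ x‖² ≤ ‖x‖²` for every finite set of charges
(`x − Σ_S Pₙ x ⊥ Σ_S Pₙ x`). [folklore] -/
theorem sum_norm_sectorProj_sq_le (hU : IsPeriodicUnitaryGroup U) (x : H) (S : Finset ℤ) :
    ∑ n ∈ S, ‖hU.sectorProj n x‖ ^ 2 ≤ ‖x‖ ^ 2 := by
  have hpy : ‖∑ n ∈ S, hU.sectorProj n x‖ ^ 2 = ∑ n ∈ S, ‖hU.sectorProj n x‖ ^ 2 :=
    hU.norm_sum_sectorProj_sq x S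
  have hxs : ⟪x, ∑ n ∈ S, hU.sectorProj n x⟫_ℂ = ⟪∑ n ∈ S, hU.sectorProj n x, ∑ n ∈ S, hU.sectorProj n x⟫_ℂ := by
    rw [inner_sum, inner_self_eq_norm_sq_to_K]
    simp_rw [hU.inner_sectorProj_self, inner_self_eq_norm_sq_to_K]
    exact_mod_cast hpy.symm
  have horth : ⟪x - ∑ n ∈ S, hU.sectorProj n x, ∑ n ∈ S, hU.sectorProj n x⟫_ℂ = 0 := by
    rw [inner_sub_left, hxs, sub_self]
  have hp := norm_add_sq_eq_norm_sq_add_norm_sq_of_inner_eq_zero _ _ horth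
  rw [sub_add_cancel] at hp
  rw [← hpy]
  nlinarith [mul_self_nonneg ‖x - ∑ n ∈ S, hU.sectorProj n x‖, hp]

/-- The squared norms `‖Pₙ x‖²` are summable over all charges (Bessel). [folklore] -/
theorem summable_norm_sectorProj_sq (hU : IsPeriodicUnitaryGroup U) (x : H) :
    Summable fun n : ℤ => ‖hU.sectorProj n x‖ ^ 2 :=
  summable_of_sum_le (fun _ => sq_nonneg _) (hU.sum_norm_sectorProj_sq_le x)

/-- **`Σₙ Pₙ x` converges** (unconditionally, in norm). [folklore] -/
theorem summable_sectorProj_apply (hU : IsPeriodicUnitaryGroup U) (x : H) :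
    Summable fun n : ℤ => hU.sectorProj n x := by
  rw [summable_iff_vanishing_norm]
  intro ε hε
  have hsum := hU.summable_norm_sectorProj_sq x
  obtain ⟨S, hS⟩ := summable_iff_vanishing_norm.1 hsum (ε ^ 2) (by positivity)
  refine ⟨S, fun T hT => ?_⟩
  have h := hS T hT
  rw [Real.norm_eq_abs, abs_of_nonneg (Finset.sum_nonneg fun _ _ => sq_nonneg _)] at h
  rw [← hU.norm_sum_sectorProj_sq x T] at h
  exact lt_of_pow_lt_pow_left₀ 2 hε.le h

/-! ### Completeness: `Σₙ Pₙ x = x` -/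

/-- A `2π`-periodic continuous function on `ℝ` all of whose Fourier coefficients over `[0, 2π]`
vanish, vanishes at `0` (indeed everywhere): Mathlib's uniform convergence of the Fourier series of
a continuous function with summable coefficients, applied to the descent to `AddCircle (2π)`.
[folklore] -/
theorem apply_zero_eq_zero_of_forall_integral_eq_zero {g : ℝ → ℂ} (hg : Continuous g)
    (hper : g 0 = g (2 * π))
    (h : ∀ n : ℤ, (∫ t in (0 : ℝ)..2 * π, exp (-(I * n * t)) * g t) = 0) : g 0 = 0 := by
  haveI : Fact (0 < 2 * π) := ⟨Real.two_pi_pos⟩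
  set G : C(AddCircle (2 * π), ℂ) :=
    ⟨AddCircle.liftIco (2 * π) 0 g, AddCircle.liftIco_zero_continuous hper hg.continuousOn⟩ with hG
  -- `G ↑t = g t` on the whole closed period
  have hGg : ∀ t ∈ Icc (0 : ℝ) (2 * π), G (t : AddCircle (2 * π)) = g t := by
    intro t ht
    show AddCircle.liftIco (2 * π) 0 g (t : AddCircle (2 * π)) = g t
    rcases ht.2.lt_or_eq with hlt | heq
    · exact AddCircle.liftIco_zero_coe_apply ⟨ht.1, hlt⟩
    · rw [heq, AddCircle.coe_period, ← QuotientAddGroup.mk_zero,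
        AddCircle.liftIco_zero_coe_apply (show (0 : ℝ) ∈ Ico 0 (2 * π) from ⟨le_rfl, Real.two_pi_pos⟩)]
      exact hper
  have hcoeff : ∀ n : ℤ, fourierCoeff (G : AddCircle (2 * π) → ℂ) n = 0 := by
    intro n
    rw [fourierCoeff_eq_intervalIntegral _ n 0, zero_add]
    have h2 : (∫ x in (0 : ℝ)..2 * π, fourier (-n) (x : AddCircle (2 * π)) • G (x : AddCircle (2 * π))) =
        ∫ t in (0 : ℝ)..2 * π, exp (-(I * n * t)) * g t := by
      refine intervalIntegral.integral_congr fun t ht => ?_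
      rw [uIcc_of_le Real.two_pi_pos.le] at ht
      simp only [smul_eq_mul]
      rw [hGg t ht, fourier_coe_apply]
      congr 1
      have hπ : (π : ℂ) ≠ 0 := by exact_mod_cast Real.pi_pos.ne'
      push_cast
      field_simp
    rw [h2, h n, smul_zero]
  have hsum : HasSum (fun i => fourierCoeff (G : AddCircle (2 * π) → ℂ) i • fourier i) G :=
    hasSum_fourier_series_of_summable (by rw [show fourierCoeff (G : AddCircle (2 * π) → ℂ) = 0 from funext hcoeff]; exact summable_zero)
  simp only [hcoeff, zero_smul] at hsum
  have hG0 : G = 0 := hsum.unique hasSum_zero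
  rw [← hGg 0 ⟨le_rfl, Real.two_pi_pos.le⟩, hG0]
  simp

/-- **A vector killed by every charge projection is zero**: all Fourier coefficients of the
continuous periodic matrix coefficients `t ↦ ⟪w, U t z⟫` vanish, so `⟪w, z⟫ = ⟪w, U 0 z⟫ = 0` for
every `w`. [folklore] -/
theorem eq_zero_of_forall_sectorProj_eq_zero (hU : IsPeriodicUnitaryGroup U) {z : H}
    (hz : ∀ n : ℤ, hU.sectorProj n z = 0) : z = 0 := by
  rw [← inner_self_eq_zero (𝕜 := ℂ)]
  have key : ∀ w : H, ⟪w, z⟫_ℂ = 0 := by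
    intro w
    set g : ℝ → ℂ := fun t => ⟪w, U t z⟫_ℂ with hg
    have hgc : Continuous g := continuous_const.inner (hU.continuous_apply z)
    have hgp : g 0 = g (2 * π) := by
      simp only [hg]
      rw [show (2 * π : ℝ) = 0 + 2 * π by ring, hU.periodic]
    have hint : ∀ n : ℤ, (∫ t in (0 : ℝ)..2 * π, exp (-(I * n * t)) * g t) = 0 := by
      intro n
      have hi : IntervalIntegrable (fun t : ℝ => exp (-(I * n * t)) • U t z) volume 0 (2 * π) :=
        (hU.continuous_integrand n z).intervalIntegrable _ _
      have h1 : (∫ t in (0 : ℝ)..2 * π, exp (-(I * n * t)) * g t) =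
          ⟪w, ∫ t in (0 : ℝ)..2 * π, exp (-(I * n * t)) • U t z⟫_ℂ := by
        rw [← innerSL_apply_apply (𝕜 := ℂ), ← (innerSL ℂ w).intervalIntegral_comp_comm hi]
        refine intervalIntegral.integral_congr fun t _ => ?_
        simp only [hg, innerSL_apply_apply, inner_smul_right]
      have h2 : (∫ t in (0 : ℝ)..2 * π, exp (-(I * n * t)) • U t z) =
          (2 * π : ℝ) • hU.sectorProj n z := by
        rw [sectorProj_apply, smul_smul, mul_one_div_cancel Real.two_pi_pos.ne', one_smul]
      rw [h1, h2, hz n, smul_zero, inner_zero_right]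
    have h0 := apply_zero_eq_zero_of_forall_integral_eq_zero hgc hgp hint
    simp only [hg, hU.map_zero, one_apply_eq_self] at h0
    exact h0
  exact key z

/-- **Completeness of the charge decomposition: `Σₙ Pₙ x = x`.** [folklore] -/
theorem hasSum_sectorProj_apply (hU : IsPeriodicUnitaryGroup U) (x : H) :
    HasSum (fun n : ℤ => hU.sectorProj n x) x := by
  obtain ⟨y, hy⟩ := hU.summable_sectorProj_apply x
  -- `Pₘ y = Pₘ x` for every `m`
  have hPy : ∀ m : ℤ, hU.sectorProj m y = hU.sectorProj m x := by
    intro m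
    have h1 : HasSum (fun n : ℤ => hU.sectorProj m (hU.sectorProj n x)) (hU.sectorProj m y) :=
      hy.mapL (hU.sectorProj m)
    have h2 : HasSum (fun n : ℤ => hU.sectorProj m (hU.sectorProj n x)) (hU.sectorProj m x) := by
      have h3 : (fun n : ℤ => hU.sectorProj m (hU.sectorProj n x)) =
          fun n => if n = m then hU.sectorProj m x else 0 := by
        funext n
        split_ifs with hnm
        · subst hnm; exact hU.sectorProj_apply_sectorProj_self n x
        · exact hU.sectorProj_apply_sectorProj_of_ne (Ne.symm hnm) x
      rw [h3]
      exact hasSum_ite_eq m _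
    exact h1.unique h2
  -- hence `x − y` is killed by every projection
  have hz : x - y = 0 := hU.eq_zero_of_forall_sectorProj_eq_zero fun n => by
    rw [map_sub, hPy n, sub_self]
  have hxy : y = x := (sub_eq_zero.1 hz).symm
  subst hxy
  exact hy

/-- `x = Σ'ₙ Pₙ x`. [folklore] -/
theorem tsum_sectorProj_apply (hU : IsPeriodicUnitaryGroup U) (x : H) :
    ∑' n : ℤ, hU.sectorProj n x = x :=
  (hU.hasSum_sectorProj_apply x).tsum_eq

/-- **Plancherel for the circle action: `‖x‖² = Σₙ ‖Pₙ x‖²`.** [folklore] -/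
theorem hasSum_norm_sectorProj_sq (hU : IsPeriodicUnitaryGroup U) (x : H) :
    HasSum (fun n : ℤ => ‖hU.sectorProj n x‖ ^ 2) (‖x‖ ^ 2) := by
  have hlim : Tendsto (fun S : Finset ℤ => ‖∑ n ∈ S, hU.sectorProj n x‖ ^ 2) atTop (𝓝 (‖x‖ ^ 2)) :=
    ((continuous_norm.pow 2).tendsto x).comp (hU.hasSum_sectorProj_apply x)
  have hlim' : Tendsto (fun S : Finset ℤ => ∑ n ∈ S, ‖hU.sectorProj n x‖ ^ 2) atTop (𝓝 (‖x‖ ^ 2)) := by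
    refine hlim.congr fun S => ?_
    exact hU.norm_sum_sectorProj_sq x S
  exact hlim'

/-- `‖x‖² = Σ'ₙ ‖Pₙ x‖²`. [folklore] -/
theorem norm_sq_eq_tsum (hU : IsPeriodicUnitaryGroup U) (x : H) :
    ‖x‖ ^ 2 = ∑' n : ℤ, ‖hU.sectorProj n x‖ ^ 2 :=
  (hU.hasSum_norm_sectorProj_sq x).tsum_eq.symm

end IsPeriodicUnitaryGroup

end Literature.Analysis.OperatorTheory
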